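import Literature.AlgebraicGeometry.Frobenioids.Thm36SubProofs
import Literature.AlgebraicGeometry.Frobenioids.Thm36SubProofs2
import Literature.AlgebraicGeometry.Frobenioids.ArchimedeanIndissectible
import HarnessLib

/-!
# Frobenioids II, Theorem 3.6 (ix) for `C^ℝ := C^rlf` — PROVED (slot `ix_R`)

Mochizuki, *The geometry of Frobenioids II: poly-Frobenioids*, Kyushu J. Math. **62** (2008) 401–460,
§3, Theorem 3.6 (ix), kurims text p. 38 [cite: MochizukiFrdII2008, Thm 3.6 (ix) p.38]:

> "(ix) Suppose that `D` is of strongly indissectible type. If `D` is not complexifiable, then we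
> assume further that `Λ ≠ ℤ`. Then `F^istr` is of strongly indissectible type."

This file closes the slot `ArchFrd.Thm36Sub.ix_R` of the sub-DAG statements file `Thm36Sub.lean`
(abc-iut cell, layer L1, row M13; seat abc-iut-w4-d074): the `Λ = ℝ` conjunct of the instance statement
`Thm36ix`, read over THE realification `C^ℝ := C^rlf` ([FrdI] Prop. 5.3) of the archimedean Frobenioid
`C` of Example 3.3 — `(C^rlf)^istr` is of strongly indissectible type ([FrdII] §0 p. 5: no object is
weakly dissectible) whenever `D` is.

PROOF (the printed "follows immediately from the definitions", p. 39, made explicit).  `C^rlf` is the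
model Frobenioid ([FrdI] Thm. 5.2 (i)) of `(Φ^rlf, ℝ · Φ^birat)`; a morphism `(B_D, β) → (A_D, α)` is a
quadruple `(deg_Fr, Base, Div, u)` subject to ONE relation, which determines `u` from the other three
(`Div_B` is the inclusion `ℝ · Φ^birat ⊆ (Φ^rlf)^gp`, and for `C` one has `ℝ · Φ^birat = (Φ^rlf)^gp`,
`Thm36Sub.realSpan_carrier_eq_top`).  Given `φᵢ : Xᵢ → A` (`i = 0, 1`) in `(C^rlf)^istr`: complete the
base arrows to a commutative square `k₀ ≫ Base(φ₀) = k₁ ≫ Base(φ₁)` from some `b ∈ Ob(D)` (strong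
indissectibility of `D`, `ArchFrd.Indissect.exists_square`); over `b` take the object `B = (b, 0)` —
isotropic by Thm. 3.6 (i) for `C^ℝ` (`Thm36Sub.istrAll_R_holds`) and NON-INITIAL in every full
subcategory (it has the endomorphism `(2, id, 0, 0) ≠ id`, `rlf_isNonemptyObj`) — and the arrows
`ψ₀ = (deg_Fr φ₁, k₀, Div(φ₁)^{1/deg_Fr φ₀}, ·)`, `ψ₁ = (deg_Fr φ₀, k₁, Div(φ₀)^{1/deg_Fr φ₁}, ·)`
(roots exist: `Φ^rlf(b)` is perfect, `IsPerfFactorial.Rlf.isPerfect`); then `ψ₀ ≫ φ₀` and `ψ₁ ≫ φ₁`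
have the same Frobenius degree, base and zero divisor, hence coincide.  So no pair `(φ₀, φ₁)` weakly
dissects `A`.  (The complexifiability proviso is idle at `Λ = ℝ`.)

Proof-only companion (no `def`); no statement of the paper is re-typed; typed ≠ proved elsewhere; nothing
here bears on [IUTchIII] Cor. 3.12.  Seat abc-iut-L1-d5 (gen 3).
-/

noncomputable section

namespace Literature.AlgebraicGeometry.Frobenioids

open CategoryTheory Opposite Literature.AnabelianGeometry.EtaleTheta
open scoped NNReal

universe v u

namespace ArchFrd

namespace Thm36Sub

variable {D : Type u} [Category.{v} D] (π : D ⥤ D0)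

/-- **Every object of every full subcategory of `C^ℝ = C^rlf` is non-initial**: `(A_D, α)` carries the
endomorphism `(2, id, 0, α)` (relation `2α + 0 = α + α`), distinct from the identity by its Frobenius
degree. [cite: MochizukiFrdII2008, Thm 3.6 (ix) p.38] -/
theorem rlf_isNonemptyObj (P : ObjectProperty (rlfCat π)) (B : P.FullSubcategory) : IsNonemptyObj B := by
  refine ⟨fun hI => ?_⟩
  have hmem : B.obj.cls ∈
      ((RealificationData.canonical (Φ π)
          (PreFrobenioid.IsPerfFactorialOn.op (isPerfFactorialOn_Φ π))).realSpan
        (PreFrobenioid.biratSubfunctor (C.toElem π))).carrier B.obj.base := by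
    rw [realSpan_carrier_eq_top]
    exact Subgroup.mem_top _
  -- the endomorphism `(2, id, 0, α)` of `B.obj = (A_D, α)`
  let e : B.obj ⟶ B.obj :=
    { degFr := 2, base := 𝟙 _, div := 1, unit := ⟨B.obj.cls, hmem⟩,
      rel := by
        rw [map_one, mul_one, pullGp_id]
        exact pow_two _ }
  have hne : e ≠ 𝟙 B.obj := by
    intro h
    have h' : (2 : ℕ+) = 1 := congrArg ModelFrobenioid.degFr h
    exact absurd h' (by decide)
  exact hne (congrArg InducedCategory.Hom.hom (hI.hom_ext (P.homMk e) (𝟙 B)))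

/-- Two morphisms of `C^rlf` with the same Frobenius degree, base arrow and zero divisor are equal: the
unit component is determined by the relation of [FrdI] Thm. 5.2 (i), `Div_B` being the INCLUSION
`ℝ · Φ^birat ⊆ (Φ^rlf)^gp`. [cite: MochizukiFrdI2008, Thm. 5.2 (i) p.100] -/
theorem rlf_hom_ext {X Y : rlfCat π} {χ χ' : X ⟶ Y}
    (hd : ModelFrobenioid.degFr χ = ModelFrobenioid.degFr χ')
    (hb : ModelFrobenioid.baseMap χ = ModelFrobenioid.baseMap χ')
    (hdiv : ModelFrobenioid.div χ = ModelFrobenioid.div χ') : χ = χ' := by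
  refine ModelFrobenioid.hom_ext hd hb hdiv ?_
  apply Subtype.ext
  have h₁ := ModelFrobenioid.rel χ
  have h₂ := ModelFrobenioid.rel χ'
  rw [hd, hb, hdiv] at h₁
  exact mul_left_cancel (h₁.symm.trans h₂)

/-- `Φ^rlf(b)` is a perfect monoid (THE realification of the perf-factorial `Φ(b) = ℝ_{≥0}`), so it has
`n`-th roots. [cite: MochizukiFrdI2008, Def. 2.4 (i) p.47] -/
theorem rlf_isPerfect (b : D) :
    IsPerfect ((RealificationData.canonical (Φ π)
      (PreFrobenioid.IsPerfFactorialOn.op (isPerfFactorialOn_Φ π))).rlf.obj (op b)) :=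
  IsPerfFactorial.Rlf.isPerfect _

/-- Every class of `(Φ^rlf)^gp(b)` lies in `(ℝ · Φ^birat)(b)` (for the archimedean Frobenioid
`ℝ · Φ^birat = (Φ^rlf)^gp`, `realSpan_carrier_eq_top`). [cite: MochizukiFrdI2008, Prop. 5.3 p.103] -/
theorem mem_realSpan (b : D)
    (c : Algebra.GrothendieckGroup ((RealificationData.canonical (Φ π)
      (PreFrobenioid.IsPerfFactorialOn.op (isPerfFactorialOn_Φ π))).rlf.obj (op b))) :
    c ∈ ((RealificationData.canonical (Φ π)
        (PreFrobenioid.IsPerfFactorialOn.op (isPerfFactorialOn_Φ π))).realSpan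
      (PreFrobenioid.biratSubfunctor (C.toElem π))).carrier b := by
  rw [realSpan_carrier_eq_top]
  exact Subgroup.mem_top _

/-- **Theorem 3.6 (ix) for `C^ℝ := C^rlf`** (slot `Thm36Sub.ix_R`, PROVED): if `D` is of strongly
indissectible type, then `(C^rlf)^istr` is of strongly indissectible type.
[cite: MochizukiFrdII2008, Thm 3.6 (ix) p.38] -/
theorem ix_R_holds : ix_R π := by
  intro hD _
  refine ⟨fun A => ?_⟩
  rintro ⟨X, φ, -, hdis⟩
  -- (1) a commutative square in `D` under the base arrows
  obtain ⟨b, k₀, k₁, hk⟩ := Indissect.exists_square hD (fun i => (X i).obj.base)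
    (fun i => ModelFrobenioid.baseMap (φ i).hom)
  -- (2) the corner object `(b, 0)`, isotropic by (i), non-initial in `(C^rlf)^istr`
  let Bo : rlfCat π := ⟨b, 1⟩
  have hBo : PreFrobenioid.IsIsotropic (rlfStr π) Bo := istrAll_R_holds π (by decide) Bo
  let B : (PreFrobenioid.isotropicObjects (rlfStr π)).FullSubcategory := ⟨Bo, hBo⟩
  have hBne : IsNonemptyObj B := rlf_isNonemptyObj π _ B
  -- (3) roots of the transported zero divisors: `d₀ ^ deg φ₀ = k₁^* Div φ₁`, `d₁ ^ deg φ₁ = k₀^* Div φ₀`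
  obtain ⟨d₀, hd₀⟩ : ∃ d₀, d₀ ^ (ModelFrobenioid.degFr (φ 0).hom : ℕ) =
      pull _ k₁ (ModelFrobenioid.div (φ 1).hom) :=
    ⟨_, (rlf_isPerfect π b).root_pow (ModelFrobenioid.degFr (φ 0).hom) _⟩
  obtain ⟨d₁, hd₁⟩ : ∃ d₁, d₁ ^ (ModelFrobenioid.degFr (φ 1).hom : ℕ) =
      pull _ k₀ (ModelFrobenioid.div (φ 0).hom) :=
    ⟨_, (rlf_isPerfect π b).root_pow (ModelFrobenioid.degFr (φ 1).hom) _⟩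
  -- (4) the arrows `ψ₀ : B → X₀`, `ψ₁ : B → X₁` with swapped Frobenius degrees
  let ψ₀ : Bo ⟶ (X 0).obj :=
    { degFr := ModelFrobenioid.degFr (φ 1).hom, base := k₀, div := d₀,
      unit := ⟨(pullGp _ k₀ (X 0).obj.cls)⁻¹ * Algebra.GrothendieckGroup.of d₀, mem_realSpan π b _⟩,
      rel := by
        show (1 : Algebra.GrothendieckGroup _) ^ _ * _ = _
        rw [one_pow, one_mul]
        exact (mul_inv_cancel_left _ _).symm }
  let ψ₁ : Bo ⟶ (X 1).obj :=
    { degFr := ModelFrobenioid.degFr (φ 0).hom, base := k₁, div := d₁,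
      unit := ⟨(pullGp _ k₁ (X 1).obj.cls)⁻¹ * Algebra.GrothendieckGroup.of d₁, mem_realSpan π b _⟩,
      rel := by
        show (1 : Algebra.GrothendieckGroup _) ^ _ * _ = _
        rw [one_pow, one_mul]
        exact (mul_inv_cancel_left _ _).symm }
  -- (5) the two composites agree
  have hχ : ψ₀ ≫ (φ 0).hom = ψ₁ ≫ (φ 1).hom := by
    refine rlf_hom_ext π ?_ ?_ ?_
    · rw [ModelFrobenioid.degFr_comp, ModelFrobenioid.degFr_comp]
      exact mul_comm _ _
    · rw [ModelFrobenioid.baseMap_comp, ModelFrobenioid.baseMap_comp]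
      exact hk
    · change pull _ k₀ (ModelFrobenioid.div (φ 0).hom) * d₀ ^ (ModelFrobenioid.degFr (φ 0).hom : ℕ) =
        pull _ k₁ (ModelFrobenioid.div (φ 1).hom) * d₁ ^ (ModelFrobenioid.degFr (φ 1).hom : ℕ)
      rw [hd₀, hd₁]
      exact mul_comm _ _
  -- (6) contradiction with the dissection hypothesis
  refine hdis (i := 0) (j := 1) (by decide) hBne
    ((PreFrobenioid.isotropicObjects (rlfStr π)).homMk ψ₀)
    ((PreFrobenioid.isotropicObjects (rlfStr π)).homMk ψ₁) ?_
  apply ObjectProperty.hom_ext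
  rw [ObjectProperty.FullSubcategory.comp_hom, ObjectProperty.FullSubcategory.comp_hom]
  exact hχ

end Thm36Sub

end ArchFrd

end Literature.AlgebraicGeometry.Frobenioids

end
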